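import Mathlib
import Literature.Probability.Percolation.BlockResampling
import Literature.Probability.Percolation.CriticalContinuity
import HarnessLib

/-!
# Stub `stub_blockDisintegration` of line `pocket-resampling-liveness-mass` (crux `PercBudgetLadder.PinholeClosing`, stmt-CriticalPhenomena-5249)

Finite-block disintegration for Bernoulli bond percolation on Z^3: for a finite edge set T, a bounded measurable phi reading only omega on T and a measurable event F, the integral of phi times the indicator of F equals the integral of phi(omega) times the probability that the hybrid (omega on T, fresh elsewhere) lies in F; plus measurability of that section probability.

Registered signature (lead prover-line-stmt-CriticalPhenomena-5249-1, skeleton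
`Cruxes/PinholeClosing/Lines/pocket_resampling_liveness_mass.lean` rev 1): proved VERBATIM below as
`Summit.CriticalPhenomena.PercolationContinuityZ3.Theorems.stub_blockDisintegration`; helper lemmas live in `namespace StubBlockDisintegration`.
No new definitions (tree vocabulary only).

Proof: both sides are expanded as finite sums over the configurations `ξ ⊆ T` of the block
(`integral_eq_sum_powerset`, `integral_comp_obs_eq_sum` of `BlockConditioning.lean`): on the left,
`φ (ω \ T ∪ ξ) = φ ξ` because `φ` reads only the block, and `∫ 𝟙_F (ω \ T ∪ ξ) dP = P {ω' | ξ ∪ ω' \ T ∈ F}`;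
on the right, the integrand is the function `ξ ↦ φ ξ · P {ω' | ξ ∪ ω' \ T ∈ F}` of `obs ω T`.
Measurability: the section probability is a function of the finite observation `obs ω T`
(`measurable_comp_obs`).
-/

noncomputable section

namespace Summit.CriticalPhenomena.PercolationContinuityZ3.Theorems

open MeasureTheory Finset
open Literature.Probability.Percolation Literature.Probability.LatticeModels
open scoped Classical

namespace StubBlockDisintegration

variable {V : Type*}

/-- Gluing a fixed block configuration `ξ` to the configuration off `T` is measurable. -/
theorem measurable_union_sdiff (T : Finset (Sym2 V)) (ξ : Set (Sym2 V)) :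
    Measurable fun ω : BondConfig V => ξ ∪ ω \ ↑T := by
  have h : (fun ω : BondConfig V => ξ ∪ ω \ ↑T) = fun ω => ω \ ↑T ∪ ξ :=
    funext fun ω => Set.union_comm _ _
  rw [h]
  exact measurable_sdiff_union T ξ

/-- The hybrid configuration restricted to the block is the block part: `(ω \ T ∪ ξ) ∩ T = ξ ∩ T`. -/
theorem sdiff_union_inter (T : Set (Sym2 V)) (ω ξ : BondConfig V) :
    (ω \ T ∪ ξ) ∩ T = ξ ∩ T := by
  ext e
  simp only [Set.mem_inter_iff, Set.mem_union, Set.mem_sdiff]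
  tauto

/-- A function reading only the block `T` is constant along the gluing `ω ↦ ω \ T ∪ ξ`. -/
theorem apply_sdiff_union_eq (T : Finset (Sym2 V)) {φ : BondConfig V → ℝ}
    (hφT : ∀ ω, φ ω = φ (ω ∩ ↑T)) (ω : BondConfig V) (ξ : Finset (Sym2 V)) :
    φ (ω \ ↑T ∪ ↑ξ) = φ ↑ξ := by
  rw [hφT, hφT ↑ξ, sdiff_union_inter]

/-- The section probability `ω ↦ P {ω' | (ω ∩ T) ∪ (ω' \ T) ∈ F}` is a function of the finite
observation `obs ω T`, hence measurable (no measurability of `F` needed). -/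
theorem measurable_measureReal_hybrid (μ : Measure (BondConfig V)) (T : Finset (Sym2 V))
    (F : Set (BondConfig V)) :
    Measurable fun ω : BondConfig V => μ.real {ω' : BondConfig V | (ω ∩ ↑T) ∪ (ω' \ ↑T) ∈ F} := by
  have h : (fun ω : BondConfig V => μ.real {ω' : BondConfig V | (ω ∩ ↑T) ∪ (ω' \ ↑T) ∈ F}) =
      fun ω => (fun ξ : Finset (Sym2 V) => μ.real {ω' : BondConfig V | ↑ξ ∪ (ω' \ ↑T) ∈ F})
        (obs ω T) := by
    funext ω
    simp only [coe_obs]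
  rw [h]
  exact measurable_comp_obs T
    (fun ξ : Finset (Sym2 V) => μ.real {ω' : BondConfig V | ↑ξ ∪ (ω' \ ↑T) ∈ F})

variable (G : SimpleGraph V) (p : unitInterval)

/-- The inner integral of the disintegration: for a block configuration `ξ`,
`∫ φ (ω \ T ∪ ξ) 𝟙_F (ω \ T ∪ ξ) dP_p(ω) = φ ξ · P_p {ω' | ξ ∪ ω' \ T ∈ F}`. -/
theorem integral_glue_eq (T : Finset (Sym2 V)) {φ : BondConfig V → ℝ} {F : Set (BondConfig V)}
    (hφT : ∀ ω, φ ω = φ (ω ∩ ↑T)) (hF : MeasurableSet F) (ξ : Finset (Sym2 V)) :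
    ∫ ω, φ (ω \ ↑T ∪ ↑ξ) * F.indicator (fun _ => (1 : ℝ)) (ω \ ↑T ∪ ↑ξ) ∂(bondPercolation G p) =
      φ ↑ξ * (bondPercolation G p).real {ω' : BondConfig V | ↑ξ ∪ (ω' \ ↑T) ∈ F} := by
  have hset : MeasurableSet {ω' : BondConfig V | ↑ξ ∪ (ω' \ ↑T) ∈ F} :=
    measurable_union_sdiff T ↑ξ hF
  have hind : ∀ ω : BondConfig V, F.indicator (fun _ => (1 : ℝ)) (ω \ ↑T ∪ ↑ξ) =
      {ω' : BondConfig V | ↑ξ ∪ (ω' \ ↑T) ∈ F}.indicator 1 ω := by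
    intro ω
    rw [Set.union_comm]
    by_cases h : ↑ξ ∪ ω \ ↑T ∈ F
    · rw [Set.indicator_of_mem h,
        Set.indicator_of_mem (show ω ∈ {ω' : BondConfig V | ↑ξ ∪ (ω' \ ↑T) ∈ F} from h),
        Pi.one_apply]
    · rw [Set.indicator_of_notMem h,
        Set.indicator_of_notMem (show ω ∉ {ω' : BondConfig V | ↑ξ ∪ (ω' \ ↑T) ∈ F} from h)]
  simp_rw [apply_sdiff_union_eq T hφT, hind]
  rw [integral_const_mul, integral_indicator_one hset]

variable [Countable V]

/-- **Finite-block disintegration.** For `φ` bounded measurable reading only the block `T` and a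
measurable event `F`: `∫ φ 𝟙_F dP_p = ∫ φ(ω) · P_p {ω' | (ω ∩ T) ∪ (ω' \ T) ∈ F} dP_p(ω)` —
conditionally on the block, the configuration off the block is a fresh Bernoulli sample. -/
theorem integral_mul_indicator_eq (T : Finset (Sym2 V)) {φ : BondConfig V → ℝ}
    {F : Set (BondConfig V)} (hφm : Measurable φ) {B : ℝ} (hB : ∀ ω, |φ ω| ≤ B)
    (hφT : ∀ ω, φ ω = φ (ω ∩ ↑T)) (hF : MeasurableSet F) :
    ∫ ω, φ ω * F.indicator (fun _ => (1 : ℝ)) ω ∂(bondPercolation G p) =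
      ∫ ω, φ ω * (bondPercolation G p).real
        {ω' : BondConfig V | (ω ∩ ↑T) ∪ (ω' \ ↑T) ∈ F} ∂(bondPercolation G p) := by
  have hgm : Measurable fun ω => φ ω * F.indicator (fun _ => (1 : ℝ)) ω :=
    hφm.mul (measurable_const.indicator hF)
  have hgK : ∀ ω, |φ ω * F.indicator (fun _ => (1 : ℝ)) ω| ≤ |B| := by
    intro ω
    rw [abs_mul]
    have h1 : |F.indicator (fun _ => (1 : ℝ)) ω| ≤ 1 := by
      by_cases h : ω ∈ F
      · rw [Set.indicator_of_mem h, abs_one]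
      · rw [Set.indicator_of_notMem h, abs_zero]
        exact zero_le_one
    calc |φ ω| * |F.indicator (fun _ => (1 : ℝ)) ω| ≤ |B| * 1 :=
          mul_le_mul ((hB ω).trans (le_abs_self B)) h1 (abs_nonneg _) (abs_nonneg _)
      _ = |B| := mul_one _
  calc ∫ ω, φ ω * F.indicator (fun _ => (1 : ℝ)) ω ∂(bondPercolation G p)
      = ∑ ξ ∈ T.powerset, (bondPercolation G p).real {ω | obs ω T = ξ} *
          ∫ ω, φ (ω \ ↑T ∪ ↑ξ) * F.indicator (fun _ => (1 : ℝ)) (ω \ ↑T ∪ ↑ξ)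
            ∂(bondPercolation G p) := integral_eq_sum_powerset G p T hgm hgK
    _ = ∑ ξ ∈ T.powerset, (bondPercolation G p).real {ω | obs ω T = ξ} *
          (φ ↑ξ * (bondPercolation G p).real {ω' : BondConfig V | ↑ξ ∪ (ω' \ ↑T) ∈ F}) :=
        Finset.sum_congr rfl fun ξ _ => by rw [integral_glue_eq G p T hφT hF ξ]
    _ = ∫ ω, (fun ξ : Finset (Sym2 V) =>
          φ ↑ξ * (bondPercolation G p).real {ω' : BondConfig V | ↑ξ ∪ (ω' \ ↑T) ∈ F}) (obs ω T)
            ∂(bondPercolation G p) :=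
        (integral_comp_obs_eq_sum G p T (fun ξ : Finset (Sym2 V) =>
          φ ↑ξ * (bondPercolation G p).real {ω' : BondConfig V | ↑ξ ∪ (ω' \ ↑T) ∈ F})).symm
    _ = ∫ ω, φ ω * (bondPercolation G p).real
          {ω' : BondConfig V | (ω ∩ ↑T) ∪ (ω' \ ↑T) ∈ F} ∂(bondPercolation G p) := by
        refine integral_congr_ae (ae_of_all _ fun ω => ?_)
        simp only [coe_obs]
        rw [← hφT ω]

end StubBlockDisintegration

/-- **Finite-block disintegration + measurability of hybrid probabilities** (line pocket-resampling-liveness-mass, stub 3). -/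
theorem stub_blockDisintegration :
    (∀ (T : Finset (Sym2 (Site 3))) (φ : BondConfig (Site 3) → ℝ) (F : Set (BondConfig (Site 3))),
      Measurable φ → (∃ B : ℝ, ∀ ω, |φ ω| ≤ B) → (∀ ω, φ ω = φ (ω ∩ ↑T)) → MeasurableSet F →
      ∫ ω, φ ω * F.indicator (fun _ => (1 : ℝ)) ω ∂(bondPercolation (zdGraph 3) (criticalProbI 3)) =
        ∫ ω, φ ω * (bondPercolation (zdGraph 3) (criticalProbI 3)).real
          {ω' : BondConfig (Site 3) | (ω ∩ ↑T) ∪ (ω' \ ↑T) ∈ F} ∂(bondPercolation (zdGraph 3) (criticalProbI 3))) ∧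
    (∀ (T : Finset (Sym2 (Site 3))) (F : Set (BondConfig (Site 3))), MeasurableSet F →
      Measurable fun ω : BondConfig (Site 3) =>
        (bondPercolation (zdGraph 3) (criticalProbI 3)).real {ω' : BondConfig (Site 3) | (ω ∩ ↑T) ∪ (ω' \ ↑T) ∈ F}) := by
  refine ⟨fun T φ F hφm hB hφT hF => ?_, fun T F _ => ?_⟩
  · obtain ⟨B, hB⟩ := hB
    exact StubBlockDisintegration.integral_mul_indicator_eq (zdGraph 3) (criticalProbI 3) T hφm hB
      hφT hF
  · exact StubBlockDisintegration.measurable_measureReal_hybrid _ T F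

end Summit.CriticalPhenomena.PercolationContinuityZ3.Theorems
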